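import Summits.BirchSwinnertonDyer.BirchSwinnertonDyer.Theorems.KatoDescentTamePotSupersingularTameLowerKimRoad
import Summits.BirchSwinnertonDyer.BirchSwinnertonDyer.Theorems.Rank1ResidualIntModelSurjectivity
import Summits.BirchSwinnertonDyer.BirchSwinnertonDyer.Theorems.Rank1ResidualX11RankOneMinimality
import Summits.BirchSwinnertonDyer.Rank1Residual.Additive.X4ThreeKuriharaCertKernel
import Summits.BirchSwinnertonDyer.Rank1Residual.X11b.ChaPairsMinimality
import Literature.NumberTheory.EllipticCurves.ManinConstantConductorLe300000
import HarnessLib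

/-!
# Route `KatoDescentTamePotSupersingular` (rung K8, sub-rung B4 (t′), cell `bsd-potss`): child crux
# `TameLowerIntrinsicNonCM` (item stmt-BirchSwinnertonDyer-19618), registered stub
# `stub_intr_kuriharaCerts_offSeed` — the PER-ROW RECORD SHAPE of the Kurihara-certificate road at
# `p ≥ 5` with every curve-side binder read off an INTEGER MODEL in the kernel (a `--supports` file;
# seat `bsd-potss-kt-kur5`, generation 0)

The registered stub (skeleton `TameLowerIntrinsicNonCM_birth.lean`, sha a28edc955ed4) asks, on every
INTRINSIC NON-CM (t′) row of analytic rank `0` at a prime `p ≥ 5` with `ρ̄_{E,p}` onto that is NOT a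
Fouquet seed row, for a modular parametrisation datum with `p ∤ c_D`, the period transfer, and ONE
Kurihara number `δ̃_n^{(k)} ≢ 0 (mod p^k)` at a cyclic Kolyvagin level `n ∈ 𝒩_k`, `k ≤ ord_p ∏ c_ℓ + 1`;
the composition `TameLowerIntrinsicNonCM_of` turns it into L₀ = `MissingLowerBoundAt W p` through
`Theorems.tameMissingLowerBoundAt_rankZero_of_kimLower` (C.-H. Kim, Amer. J. Math. 148 (2026) Thm. 1.8 (6),
tree fact `Kim2026.rankZero_le_padicValNat_sha_of_kuriharaNumber_ne_zero`, NO reduction hypothesis at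
`p`). Class-wide the stub is Kurihara's conjecture (= Kato's IMC with `μ = 0`) and stays OPEN. This file
types the road PER ROW, in the n1011 record pattern of `Additive/X4ThreeKuriharaCertRecordsS2_*.lean`
(`p = 3`, announced leaf) moved to `p ≥ 5` (PUBLISHED leaf):

* §1 the record shape with the period binder DISCHARGED by optimality (`X4.periodTransfer_of_optimal`)
  and the Manin binder either displayed (`hc`) or discharged at level `N ≤ 300000` by the named
  database fact `cremona_abs_maninConstant_eq_one_of_level_le_300000`
  (`tameMissingLowerBoundAt_rankZero_of_optimal_of_cert`, `…_of_unitLevel`, `…_of_le_300000`);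
* §2 the same from an INTEGER MODEL: surjectivity of `ρ̄_{E,p}` from three Serre Prop-19 witnesses
  (kernel point counts; `IntModel.hasSurjectiveModNGaloisRep_of_intModel_of_serreWitnesses`), the
  level `n = ℓ₁ℓ₂ ∈ 𝒩₁(E,p)` and the cyclicity binder `#Ẽ(𝔽_ℓ)[p] ≤ p` from two kernel point counts
  (`Additive.isKolyvaginPrime_of_intModel_of_card`, `Additive.forall_card_torsion_le_of_pair` — the
  reading `p² ∤ #Ẽ(𝔽_ℓ)`), so that a row record carries exactly: `r_an = 0` (`hr`), the OPTIMAL datum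
  (`D`, `hopt`), and the VALUE `hδ : ∃ ψ, δ̃_n ≢ 0 (mod p)` — an EVIDENCE binder instantiated by the
  seat's kit census (engine Bf numerics certified by exact Hecke relations + engine B / GEN22 V41
  cross-checks; job ids in the record files and the item's evidence);
* §3 the `BSD(E,p)` form on a unit row with `p ∤ ∏ c_ℓ` (Kim Thm. 1.8 (1),(6) unit fact
  `Kim2022_rankZero_padicValRat_sha_of_kuriharaNumber_ne_zero_of_maninConstant`; `Addv` read off the
  model by `Additive.addv_of_intModel`), and the CLASS form: L₀ at every member isogenous to a
  certified member (Cassels' invariance, `TwistComparison.missingLowerBoundAt_of_isIsogenous`).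

HONEST LABEL. Every theorem is CONDITIONAL on named PUBLISHED inputs in hypothesis position (Kim 2026
Thm. 1.8, GZK, modularity, Cassels, Cremona's Manin-constant computation) and on per-row EVIDENCE
binders (`r_an = 0`, the optimal datum, the Kurihara value); per-row instances of the stub's slot,
NOT the class-wide stub; the item is NOT closed and nothing is booked; BSD is not proved by any of this.
Seat `bsd-potss-kt-kur5` (prover-bsd-potss-kt-kur5-g0-0), generation 0.

References: [Kim2022StructureSelmer] Thm. 1.9 (1),(6), Thm. 1.11, §1.2.2, §1.3.5, §1.4.3 (arXiv v4 =
Amer. J. Math. 148 (2026) Thm. 1.8/1.10); [Serre1972] §2.8 Prop. 19; [AgasheRibetStein2006] Thm. 2.6;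
[CesnaviciusNeururerSaha2023] §1 (Cremona's Manin-constant computation to `300000`); [Cremona1997]
§2.8; [MilneADT2006] Thm. I.7.3 (Cassels); [Miller2011LMS] Def. 1.1; [SilvermanAEC2009] VII.1, VII.5.
-/

set_option autoImplicit false
-- sibling precedent (`KatoDescentTamePotSupersingularTameLowerKimRoad.lean`): the directory name repeats the summit name
set_option linter.dupNamespace false

noncomputable section

open scoped Classical MatrixGroups ModularForm

namespace Summit.BirchSwinnertonDyer.BirchSwinnertonDyer.Theorems

open CongruenceSubgroup WeierstrassCurve Literature.NumberTheory.EllipticCurves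
  Literature.NumberTheory.EllipticCurves.ModularForms
  Literature.NumberTheory.EllipticCurves.Rank1Residual
  Literature.NumberTheory.EllipticCurves.Rank1Residual.Typed
  Summit.BirchSwinnertonDyer.Rank1Residual
  Summit.BirchSwinnertonDyer.Rank1Residual.Additive
  Summit.BirchSwinnertonDyer.Rank1Residual.X4
  Summit.BirchSwinnertonDyer.BirchSwinnertonDyer.Rank1Residual.IntModel
  Summit.BirchSwinnertonDyer.BirchSwinnertonDyer.Theses.KatoDescentTamePotSupersingular

/-! ## §1 The record shape: period binder discharged by optimality; Manin displayed or discharged -/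

section Optimal

variable {W : WeierstrassCurve ℚ} [W.IsElliptic] [W.IsGloballyMinimal]

/-- **L₀ at a rank-`0` row, `p ≥ 5`, `ρ̄_{E,p}` onto, from an OPTIMAL datum with `p ∤ c_D` and ONE
level-`k` Kurihara certificate `k ≤ ord_p ∏ c_ℓ + 1`** (Kim 2026 Thm. 1.8 (6), tree fact `hKim`, any
reduction at `p`; GZK; modularity): the route's `tameMissingLowerBoundAt_rankZero_of_kimLower` with the
period transfer discharged by `X4.periodTransfer_of_optimal` and the value as an existential EVIDENCE
binder `hδ`. Per row; NOT the class-wide stub. [cite: Kim2022StructureSelmer, Thm. 1.9 (6) (PDF p. 8), §1.3.5, §1.5.1]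
[cite: CremonaAlgorithms1997, §2.8 (p. 26)] [cite: Miller2011LMS, Def. 1.1] -/
theorem tameMissingLowerBoundAt_rankZero_of_optimal_of_cert
    (hKim : Kim2026.rankZero_le_padicValNat_sha_of_kuriharaNumber_ne_zero)
    (hGZK : rank_eq_analyticRank_of_analyticRank_le_one) (hmod : hasEntireLFunction_rat)
    (p : ℕ) [Fact p.Prime] (hp5 : 5 ≤ p) (hsurj : Surj W p) (hr : W.analyticRank = 0)
    {N : ℕ} [NeZero N] (D : ModularParametrizationData W N) (hc : ¬ (p : ℤ) ∣ D.maninConstant)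
    (hopt : ∀ z ∈ D.L.lattice, ∃ w ∈ periodLattice D.f, z = D.c * w)
    (k n : ℕ) [NeZero n] (hk : 1 ≤ k) (hkt : k ≤ padicValNat p W.tamagawaProduct + 1)
    (hn : Kato.IsKolyvaginProduct W p k n)
    (hcyc : ∀ (ℓ : ℕ) [Fact ℓ.Prime], ℓ ∣ n →
      Nat.card {P : ((WeierstrassCurve.integralModelInt W).map
          (Int.castRingHom (ZMod ℓ))).toAffine.Point // p • P = 0} ≤ p)
    (hδ : ∃ ψ : (ℓ : ℕ) → (ZMod ℓ)ˣ →* Multiplicative (ZMod (p ^ k)),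
      (∀ ℓ ∈ n.primeFactors, Function.Surjective (ψ ℓ)) ∧ kuriharaNumber D.f (p ^ k) n ψ ≠ 0) :
    MissingLowerBoundAt W p := by
  obtain ⟨ψ, hψ, hδ⟩ := hδ
  exact X4.missingLowerBoundAt_rankZero_of_kimLower W p hKim hGZK hp5 hsurj
    ((W.analyticRank_eq_zero_iff_holds (hmod W)).mp hr) D hc (periodTransfer_of_optimal p D hopt hc) k n
    hk hkt hn hcyc ψ hψ hδ

/-- **The UNIT-level record (`k = 1`, no Tamagawa binder)**: a mod-`p` UNIT Kurihara number at a cyclic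
`n ∈ 𝒩₁(E,p)` gives L₀ on the row whatever `ord_p ∏ c_ℓ` is (`1 ≤ ord_p ∏ c_ℓ + 1`). Per row.
[cite: Kim2022StructureSelmer, Thm. 1.9 (6) and Thm. 1.11 (PDF p. 8)] [cite: Miller2011LMS, Def. 1.1] -/
theorem tameMissingLowerBoundAt_rankZero_of_optimal_of_unitLevel
    (hKim : Kim2026.rankZero_le_padicValNat_sha_of_kuriharaNumber_ne_zero)
    (hGZK : rank_eq_analyticRank_of_analyticRank_le_one) (hmod : hasEntireLFunction_rat)
    (p : ℕ) [Fact p.Prime] (hp5 : 5 ≤ p) (hsurj : Surj W p) (hr : W.analyticRank = 0)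
    {N : ℕ} [NeZero N] (D : ModularParametrizationData W N) (hc : ¬ (p : ℤ) ∣ D.maninConstant)
    (hopt : ∀ z ∈ D.L.lattice, ∃ w ∈ periodLattice D.f, z = D.c * w)
    (n : ℕ) [NeZero n] (hn : Kato.IsKolyvaginProduct W p 1 n)
    (hcyc : ∀ (ℓ : ℕ) [Fact ℓ.Prime], ℓ ∣ n →
      Nat.card {P : ((WeierstrassCurve.integralModelInt W).map
          (Int.castRingHom (ZMod ℓ))).toAffine.Point // p • P = 0} ≤ p)
    (hδ : ∃ ψ : (ℓ : ℕ) → (ZMod ℓ)ˣ →* Multiplicative (ZMod (p ^ 1)),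
      (∀ ℓ ∈ n.primeFactors, Function.Surjective (ψ ℓ)) ∧ kuriharaNumber D.f (p ^ 1) n ψ ≠ 0) :
    MissingLowerBoundAt W p :=
  tameMissingLowerBoundAt_rankZero_of_optimal_of_cert hKim hGZK hmod p hp5 hsurj hr D hc hopt 1 n le_rfl
    (Nat.le_add_left 1 _) hn hcyc hδ

/-- **The UNIT-level record with the Manin binder discharged at level `N ≤ 300000`** by the named fact
`cremona_abs_maninConstant_eq_one_of_level_le_300000` (Cremona's completed modular-symbol computation,
asserted in refereed print: `|c| = 1` for every optimal curve of conductor `≤ 300000`).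
[cite: CesnaviciusNeururerSaha2023, §1] [cite: AgasheRibetStein2006, Thm. 2.6] [cite: Kim2022StructureSelmer, Thm. 1.9 (6)] -/
theorem tameMissingLowerBoundAt_rankZero_of_optimal_of_unitLevel_of_le_300000
    (hKim : Kim2026.rankZero_le_padicValNat_sha_of_kuriharaNumber_ne_zero)
    (hGZK : rank_eq_analyticRank_of_analyticRank_le_one) (hmod : hasEntireLFunction_rat)
    (h300 : cremona_abs_maninConstant_eq_one_of_level_le_300000)
    (p : ℕ) [Fact p.Prime] (hp5 : 5 ≤ p) (hsurj : Surj W p) (hr : W.analyticRank = 0)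
    {N : ℕ} [NeZero N] (hN : N ≤ 300000) (D : ModularParametrizationData W N)
    (hopt : ∀ z ∈ D.L.lattice, ∃ w ∈ periodLattice D.f, z = D.c * w)
    (n : ℕ) [NeZero n] (hn : Kato.IsKolyvaginProduct W p 1 n)
    (hcyc : ∀ (ℓ : ℕ) [Fact ℓ.Prime], ℓ ∣ n →
      Nat.card {P : ((WeierstrassCurve.integralModelInt W).map
          (Int.castRingHom (ZMod ℓ))).toAffine.Point // p • P = 0} ≤ p)
    (hδ : ∃ ψ : (ℓ : ℕ) → (ZMod ℓ)ˣ →* Multiplicative (ZMod (p ^ 1)),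
      (∀ ℓ ∈ n.primeFactors, Function.Surjective (ψ ℓ)) ∧ kuriharaNumber D.f (p ^ 1) n ψ ≠ 0) :
    MissingLowerBoundAt W p :=
  tameMissingLowerBoundAt_rankZero_of_optimal_of_unitLevel hKim hGZK hmod p hp5 hsurj hr D
    (not_dvd_maninConstant_of_level_le_300000 h300 W D hopt hN (Fact.out : p.Prime)) hopt n hn hcyc hδ

end Optimal

/-! ## §2 The record shape READ OFF AN INTEGER MODEL: surjectivity and the level in the kernel -/

section IntModelRoad

variable {W : WeierstrassCurve ℚ} [W.IsElliptic] [W.IsGloballyMinimal] {E₀ : WeierstrassCurve ℤ}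
  (hI : integralModelInt W = E₀)
include hI

/-- **L₀ at a rank-`0` row, `p ≥ 5`, from an integer model, three Serre witnesses, and a cyclic level
`ℓ₁ℓ₂ ∈ 𝒩₁(E,p)` given by two point counts** — the per-row record shape of this file. Kernel side:
`integralModelInt W = E₀`; good primes `q₁, q₂, q₃ ≠ p` (`qᵢ ∤ Δ(E₀)`) with point counts meeting Serre's
Prop. 19 (i), (ii), (iii) modulo `p` (so `ρ̄_{E,p}` is onto); primes `ℓ₁ ≠ ℓ₂`, `ℓᵢ ≠ p`, `ℓᵢ ∤ Δ(E₀)`,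
`ℓᵢ ≡ 1 (mod p)`, point counts `nᵢ` with `p ∣ nᵢ` (`a_{ℓᵢ} ≡ ℓᵢ + 1`) and `p² ∤ nᵢ` (cyclic
`p`-torsion). Hypothesis side: Kim 2026 Thm. 1.8 (6) `hKim`, GZK, modularity; `r_an = 0`; an OPTIMAL
datum `D` with `p ∤ c_D`; the VALUE `hδ`. Per row; NOT the class-wide stub.
[cite: Kim2022StructureSelmer, Thm. 1.9 (6), §1.2.2 (PDF pp. 4, 8)] [cite: Serre1972, §2.8 Prop. 19]
[cite: CremonaAlgorithms1997, §2.8] [cite: Miller2011LMS, Def. 1.1] -/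
theorem tameMissingLowerBoundAt_rankZero_of_intModel_of_serre_of_pair
    (hKim : Kim2026.rankZero_le_padicValNat_sha_of_kuriharaNumber_ne_zero)
    (hGZK : rank_eq_analyticRank_of_analyticRank_le_one) (hmod : hasEntireLFunction_rat)
    (p : ℕ) [Fact p.Prime] (hp5 : 5 ≤ p)
    (q₁ q₂ q₃ : ℕ) [Fact q₁.Prime] [Fact q₂.Prime] [Fact q₃.Prime]
    (hq₁ : q₁ ≠ p) (hq₂ : q₂ ≠ p) (hq₃ : q₃ ≠ p)
    (hΔq₁ : ¬ (q₁ : ℤ) ∣ E₀.Δ) (hΔq₂ : ¬ (q₂ : ℤ) ∣ E₀.Δ) (hΔq₃ : ¬ (q₃ : ℤ) ∣ E₀.Δ)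
    {m₁ m₂ m₃ : ℕ}
    (hm₁ : Nat.card ((E₀.map (Int.castRingHom (ZMod q₁))).toAffine.Point) = m₁)
    (hm₂ : Nat.card ((E₀.map (Int.castRingHom (ZMod q₂))).toAffine.Point) = m₂)
    (hm₃ : Nat.card ((E₀.map (Int.castRingHom (ZMod q₃))).toAffine.Point) = m₃)
    (hi : IsSquare ((((q₁ : ℤ) + 1 - m₁ : ℤ) : ZMod p) ^ 2 - 4 * q₁) ∧
      (((q₁ : ℤ) + 1 - m₁ : ℤ) : ZMod p) ^ 2 - 4 * q₁ ≠ 0 ∧ (((q₁ : ℤ) + 1 - m₁ : ℤ) : ZMod p) ≠ 0)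
    (hii : ¬ IsSquare ((((q₂ : ℤ) + 1 - m₂ : ℤ) : ZMod p) ^ 2 - 4 * q₂) ∧
      (((q₂ : ℤ) + 1 - m₂ : ℤ) : ZMod p) ≠ 0)
    (hiii : ∃ u : ZMod p, (((q₃ : ℤ) + 1 - m₃ : ℤ) : ZMod p) ^ 2 = u * q₃ ∧
      u ≠ 0 ∧ u ≠ 1 ∧ u ≠ 2 ∧ u ≠ 4 ∧ u ^ 2 - 3 * u + 1 ≠ 0)
    (ℓ₁ ℓ₂ : ℕ) [Fact ℓ₁.Prime] [Fact ℓ₂.Prime] (hℓ : ℓ₁ ≠ ℓ₂) (hℓ₁p : ℓ₁ ≠ p) (hℓ₂p : ℓ₂ ≠ p)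
    (hΔ₁ : ¬ (ℓ₁ : ℤ) ∣ E₀.Δ) (hΔ₂ : ¬ (ℓ₂ : ℤ) ∣ E₀.Δ)
    (h1₁ : ℓ₁ ≡ 1 [MOD p ^ 1]) (h1₂ : ℓ₂ ≡ 1 [MOD p ^ 1])
    {n₁ n₂ : ℕ}
    (hc₁ : Nat.card ((E₀.map (Int.castRingHom (ZMod ℓ₁))).toAffine.Point) = n₁)
    (hc₂ : Nat.card ((E₀.map (Int.castRingHom (ZMod ℓ₂))).toAffine.Point) = n₂)
    (hd₁ : p ^ 1 ∣ n₁) (hd₂ : p ^ 1 ∣ n₂) (hsq₁ : ¬ p ^ 2 ∣ n₁) (hsq₂ : ¬ p ^ 2 ∣ n₂)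
    (hr : W.analyticRank = 0)
    {N : ℕ} [NeZero N] (D : ModularParametrizationData W N) (hc : ¬ (p : ℤ) ∣ D.maninConstant)
    (hopt : ∀ z ∈ D.L.lattice, ∃ w ∈ periodLattice D.f, z = D.c * w)
    (hδ : ∃ ψ : (ℓ : ℕ) → (ZMod ℓ)ˣ →* Multiplicative (ZMod (p ^ 1)),
      (∀ ℓ ∈ (ℓ₁ * ℓ₂).primeFactors, Function.Surjective (ψ ℓ)) ∧
        kuriharaNumber D.f (p ^ 1) (ℓ₁ * ℓ₂) ψ ≠ 0) :
    MissingLowerBoundAt W p := by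
  have hsurj : Surj W p :=
    hasSurjectiveModNGaloisRep_of_intModel_of_serreWitnesses hI p hp5 q₁ q₂ q₃ hq₁ hq₂ hq₃ hΔq₁ hΔq₂
      hΔq₃ hm₁ hm₂ hm₃ hi hii hiii
  have hk₁ : Kato.IsKolyvaginPrime W p 1 ℓ₁ :=
    isKolyvaginPrime_of_intModel_of_card hI p 1 ℓ₁ hℓ₁p hΔ₁ h1₁ hc₁ hd₁
  have hk₂ : Kato.IsKolyvaginPrime W p 1 ℓ₂ :=
    isKolyvaginPrime_of_intModel_of_card hI p 1 ℓ₂ hℓ₂p hΔ₂ h1₂ hc₂ hd₂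
  haveI : NeZero (ℓ₁ * ℓ₂) := ⟨mul_ne_zero (Fact.out : ℓ₁.Prime).ne_zero (Fact.out : ℓ₂.Prime).ne_zero⟩
  exact tameMissingLowerBoundAt_rankZero_of_optimal_of_unitLevel hKim hGZK hmod p hp5 hsurj hr D hc hopt
    (ℓ₁ * ℓ₂) (isKolyvaginProduct_mul hk₁ hk₂ hℓ) (forall_card_torsion_le_of_pair hI p ℓ₁ ℓ₂ hc₁ hc₂ hsq₁ hsq₂)
    hδ

end IntModelRoad

/-! ## §3 The `BSD(E,p)` form on a unit row with `p ∤ ∏ c_ℓ`, and the class form by Cassels -/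

section BsdpAndClass

variable {W : WeierstrassCurve ℚ} [W.IsElliptic] [W.IsGloballyMinimal]

/-- **`BSD(E,p)` (Miller) on a rank-`0` row, `p ≥ 5`, `ρ̄` onto, ADDITIVE at `p` (read off an integer
model: `p ∣ Δ(E₀)`, `p ∣ c₄(E₀)`), `p ∤ ∏ c_ℓ`, from an OPTIMAL datum with `p ∤ c_D` and ONE UNIT
Kurihara number at a cyclic `n ∈ 𝒩₁(E,p)`** (Kim 2026 Thm. 1.8 (1),(6) unit fact `hKim1`): the cell's
`X4.bsdp_of_kuriharaUnitAt_of_analyticRank_eq_zero` with the period binder discharged by optimality and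
the unit packaged by `Additive.kuriharaUnitAt_of_level`; both halves (`MissingPPartAt`) follow. Per row.
[cite: Kim2022StructureSelmer, Thm. 1.9 (1) and (6), Thm. 1.11 (PDF pp. 7–8), §1.3.5]
[cite: SilvermanAEC2009, VII.5 Prop. 5.1 (c)] [cite: Miller2011LMS, Def. 1.1] -/
theorem tameBsdp_rankZero_of_intModel_of_optimal_of_unitLevel
    (hKim1 : Kim2022_rankZero_padicValRat_sha_of_kuriharaNumber_ne_zero_of_maninConstant)
    (hGZK : rank_eq_analyticRank_of_analyticRank_le_one) (hmod : hasEntireLFunction_rat)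
    {E₀ : WeierstrassCurve ℤ} (hI : integralModelInt W = E₀)
    (p : ℕ) [Fact p.Prime] (hp5 : 5 ≤ p) (hΔ : (p : ℤ) ∣ E₀.Δ) (hc₄ : (p : ℤ) ∣ E₀.c₄)
    (hsurj : Surj W p) (hr : W.analyticRank = 0) (htam : ¬ p ∣ W.tamagawaProduct)
    {N : ℕ} [NeZero N] (D : ModularParametrizationData W N) (hc : ¬ (p : ℤ) ∣ D.maninConstant)
    (hopt : ∀ z ∈ D.L.lattice, ∃ w ∈ periodLattice D.f, z = D.c * w)
    (n : ℕ) [NeZero n] (hn : Kato.IsKolyvaginProduct W p 1 n)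
    (hcyc : ∀ (ℓ : ℕ) [Fact ℓ.Prime], ℓ ∣ n →
      Nat.card {P : ((WeierstrassCurve.integralModelInt W).map
          (Int.castRingHom (ZMod ℓ))).toAffine.Point // p • P = 0} ≤ p)
    (hδ : ∃ ψ : (ℓ : ℕ) → (ZMod ℓ)ˣ →* Multiplicative (ZMod (p ^ 1)),
      (∀ ℓ ∈ n.primeFactors, Function.Surjective (ψ ℓ)) ∧ kuriharaNumber D.f (p ^ 1) n ψ ≠ 0) :
    BSDp W p ∧ MissingPPartAt W p := by
  have hX : ClassX4 W p :=
    ⟨by rintro rfl; omega, addv_of_intModel hI p hΔ hc₄,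
      hasIrreducibleModPGaloisRep_of_hasSurjectiveModNGaloisRep W p hsurj⟩
  have hB : BSDp W p :=
    X4.bsdp_of_kuriharaUnitAt_of_analyticRank_eq_zero W p hKim1 hGZK hmod hp5 hX hsurj hr D hc
      (periodTransfer_of_optimal p D hopt hc) htam (kuriharaUnitAt_of_level p D.f n hn hcyc hδ)
  haveI : Finite W.sha := (hGZK W (by rw [hr]; exact zero_le_one)).2
  exact ⟨hB, missingPPartAt_of_bsdp W p hB⟩

/-- **L₀ at EVERY member of the isogeny class of a certified row** (Cassels' invariance of the BSD
quotient `hCassels`, GZK, modularity; `TwistComparison.missingLowerBoundAt_of_isIsogenous`): the stub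
quantifies over ALL globally minimal members of an intrinsic class, and a census certifies the optimal
member only; this moves L₀ to the other members (the 2-isogenous partners of the two-member (t′)
classes). Per class; conditional. [cite: MilneADT2006, Thm. I.7.3] [cite: Miller2011LMS, Def. 1.1] -/
theorem tameMissingLowerBoundAt_of_isIsogenous_certifiedMember (hCassels : bsdRHS_eq_of_isIsogenous)
    (hGZK : rank_eq_analyticRank_of_analyticRank_le_one) (hmod : hasEntireLFunction_rat)
    (W : WeierstrassCurve ℚ) [W.IsElliptic] [W.IsGloballyMinimal] (p : ℕ) [Fact p.Prime]
    (hr : W.analyticRank = 0)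
    (W' : WeierstrassCurve ℚ) [W'.IsElliptic] [W'.IsGloballyMinimal] (hiso : IsIsogenous W W')
    (hlow : MissingLowerBoundAt W' p) : MissingLowerBoundAt W p := by
  have hr' : W'.analyticRank = 0 := by rw [← analyticRank_eq_of_isIsogenous' hiso, hr]
  exact TwistComparison.missingLowerBoundAt_of_isIsogenous W' W p hCassels hGZK hmod
    hiso.symm_of_charZero (by rw [hr']; exact zero_le_one) hlow

end BsdpAndClass

end Summit.BirchSwinnertonDyer.BirchSwinnertonDyer.Theorems

end
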